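import Mathlib
import Literature.Computability.AlgebraicComplexity.OrbitClosureProofs
import Literature.Computability.AlgebraicComplexity.DeterminantalComplexityProofs
import Literature.Computability.AlgebraicComplexity.StandardFamiliesProofs

/-!
# Crux `DetQP.DetqpSuperquadratic` (stmt-ValiantsHypothesis-0318), line
# `linear-homogenisation-transfer` — stub `stub_initialFormFamily` (B2): the rescaled graded
# homogenisation of an affine determinantal expression

Let `F = det A` with `A` an `m × m` matrix of affine linear forms in the variables `x_s`
(`s : Fin n × Fin n`), let `ι` place these variables among the `m²` matrix variables `X_p`
(`p : Fin m × Fin m`) and let `X_y` be a matrix variable not of the form `X_{ι s}`.  Suppose `F` has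
no homogeneous component of degree `< n ≤ m` (it has none of degree `> m` either, `deg F ≤ m`).
Then for every `t ≠ 0`

  `Σ_{e ≤ m−n} tᵉ · X_y^(m−n−e) · F_{n+e}(X_ι) ∈ End · det_m`,

where `F_d` is the degree-`d` homogeneous component.  Indeed, substitute into `det_m` the linear forms
`r_i · (a₀ X_y + t Σ_s a_s X_{ι s})` for the entries `a₀ + Σ_s a_s x_s` of `A`, with the row weights
`r_i = t^(−n)` for one row and `1` for the others: at a point `x` with `x_y ≠ 0` the substituted
determinant is `t^(−n) x_y^m F(t x_ι / x_y) = Σ_d t^(d−n) x_y^(m−d) F_d(x_ι)` (pull `x_y` out of every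
row, grade `F`), so the two polynomials agree wherever `x_y ≠ 0`, hence agree after multiplication
by `X_y`, hence agree (`ℂ[X]` is a domain).  This is the homogenisation of Mulmuley–Sohoni 2001,
Prop. 4.4 (tree: `Literature.Computability.AlgebraicComplexity.X_pow_mul_rename_mem_endOrbit_detPoly`,
the case of a form) followed by the rescaling `X_{ι s} ↦ t X_{ι s}` and a row rescaling; folklore.
The lead lets `t → 0` (stub `stub_zariskiLimit`) to put the padded initial form `X_y^(m−n) F_n(X_ι)`
into `Δ[det_m]`.
-/

-- `Summit.ValiantsHypothesis.ValiantsHypothesis.…` is the tree's mandated single-conjunct layout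
-- (Sub = Summit), so the duplicated namespace component is intended.
set_option linter.dupNamespace false

noncomputable section

open MvPolynomial Matrix
open Literature.Computability.AlgebraicComplexity

namespace Summit.ValiantsHypothesis.ValiantsHypothesis.Theorems.DetQPDetqpSuperquadratic

namespace InitialFormFamily

/-- Graded evaluation at a rescaled point: if `deg F ≤ m` then
`F(c • z) = Σ_{d ≤ m} c^d F_d(z)`. [folklore] -/
theorem eval_smul_eq_sum_homogeneousComponent {τ K : Type*} [Field K] (F : MvPolynomial τ K)
    {m : ℕ} (hF : F.totalDegree ≤ m) (c : K) (z : τ → K) :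
    eval (c • z) F =
      ∑ d ∈ Finset.range (m + 1), c ^ d * eval z (homogeneousComponent d F) := by
  have hsum : ∑ d ∈ Finset.range (m + 1), homogeneousComponent d F = F := by
    rw [← Finset.sum_subset (Finset.range_subset_range.mpr (Nat.succ_le_succ hF))]
    · exact sum_homogeneousComponent (φ := F)
    · intro d _ hd
      apply homogeneousComponent_eq_zero
      rw [Finset.mem_range, not_lt] at hd
      omega
  conv_lhs => rw [← hsum]
  rw [map_sum]
  exact Finset.sum_congr rfl fun d _ =>
    eval_smul_of_isHomogeneous (homogeneousComponent_isHomogeneous d F) c z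

/-- The affine-entry bookkeeping: for an affine `a = a₀ + Σ_s a_s x_s` and a point `x` with
`x_y ≠ 0`, `a₀ x_y + t Σ_s a_s x_{ι s} = x_y · a(t x_ι / x_y)`. [folklore] -/
theorem sum_homogenisedCoeff_mul_eq {τ P K : Type*} [Fintype τ] [Fintype P] [DecidableEq τ]
    [DecidableEq P] [Field K] {a : MvPolynomial τ K} (ha : a.totalDegree ≤ 1) (ι : τ → P) (y : P)
    (t : K) (x : P → K) (hx : x y ≠ 0) :
    ∑ p, ((if p = y then coeff 0 a else 0) +
        ∑ s, if p = ι s then t * coeff (Finsupp.single s 1) a else 0) * x p =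
      x y * eval (fun s => t * x (ι s) / x y) a := by
  rw [eval_eq_of_totalDegree_le_one ha]
  simp only [add_mul, Finset.sum_add_distrib, Finset.sum_mul, ite_mul, zero_mul]
  rw [Finset.sum_comm]
  simp only [mul_add, Finset.mul_sum]
  congr 1
  · rw [Finset.sum_ite_eq' Finset.univ y, if_pos (Finset.mem_univ _)]
    ring
  · refine Finset.sum_congr rfl fun s _ => ?_
    rw [Finset.sum_ite_eq' Finset.univ (ι s), if_pos (Finset.mem_univ _)]
    field_simp

end InitialFormFamily

/-- Registered stub **B2** `stub_initialFormFamily`: the graded homogenisation of an affine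
determinantal expression, rescaled.  If `F = det A` with `A` affine of size `m`, `F` has no
homogeneous component of degree `< n ≤ m`, `ι` places the variables of `F` among the `m²` matrix
variables and the matrix variable `y` is not in the image of `ι`, then for every `t ≠ 0`
  `Σ_{e ≤ m−n} tᵉ · X_y^(m−n−e) · F_{n+e}(X_ι) ∈ End · det_m`
(substitute `r_i (a₀ X_y + t Σ_s a_s X_{ι s})` for the entries `a₀ + Σ a_s x_s` of `A`, row weights
`r = (t^(−n), 1, …, 1)`; compare values where `x_y ≠ 0`, then cancel `X_y`).  The hypothesis
`y ∉ Set.range ι` is part of the registered signature but is not used by this proof.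
[folklore; Mulmuley–Sohoni 2001 Prop. 4.4 + Landsberg 2017 §6] -/
theorem stub_initialFormFamily :
    ∀ (n m : ℕ) (F : MvPolynomial (Fin n × Fin n) ℂ) (ι : Fin n × Fin n → Fin m × Fin m)
      (y : Fin m × Fin m),
      y ∉ Set.range ι → n ≤ m → HasDetRepr F m →
      (∀ d : ℕ, d < n → homogeneousComponent d F = 0) →
      ∀ t : ℂ, t ≠ 0 →
        (∑ e ∈ Finset.range (m - n + 1),
            t ^ e • (X y ^ (m - n - e) * rename ι (homogeneousComponent (n + e) F)))
          ∈ endOrbit (Fin m × Fin m) ℂ (detPoly (Fin m) ℂ) := by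
  intro n m F ι y _ hnm hA hlow t ht
  classical
  obtain ⟨A, hAdeg, hAdet⟩ := hA
  have hFdeg : F.totalDegree ≤ m := totalDegree_le_of_hasDetRepr_holds ⟨A, hAdeg, hAdet⟩
  -- Step 1: re-index the family as a sum over all degrees `d ≤ m`
  have hreindex : (∑ e ∈ Finset.range (m - n + 1),
        t ^ e • (X y ^ (m - n - e) * rename ι (homogeneousComponent (n + e) F))) =
      ∑ d ∈ Finset.range (m + 1),
        ((t ^ n)⁻¹ * t ^ d) • (X y ^ (m - d) * rename ι (homogeneousComponent d F)) := by
    symm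
    rw [← Finset.sum_range_add_sum_Ico _ (Nat.le_succ_of_le hnm)]
    have h1 : ∑ d ∈ Finset.range n,
        ((t ^ n)⁻¹ * t ^ d) • (X y ^ (m - d) * rename ι (homogeneousComponent d F)) = 0 := by
      refine Finset.sum_eq_zero fun d hd => ?_
      rw [hlow d (Finset.mem_range.mp hd), map_zero, mul_zero, smul_zero]
    rw [h1, zero_add, Finset.sum_Ico_eq_sum_range, Nat.succ_sub hnm]
    refine Finset.sum_congr rfl fun e _ => ?_
    rw [pow_add, ← mul_assoc, inv_mul_cancel₀ (pow_ne_zero n ht), one_mul, Nat.sub_sub]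
  rw [hreindex]
  -- Step 2: the substitution matrix (homogenise with `X y`, rescale `X (ι s)` by `t`, and rescale
  -- the row `y.1` by `t⁻ⁿ`)
  set r : Fin m → ℂ := fun i => if i = y.1 then (t ^ n)⁻¹ else 1 with hr
  set M : Matrix (Fin m × Fin m) (Fin m × Fin m) ℂ := fun p ij =>
    r ij.1 * ((if p = y then coeff 0 (A ij.1 ij.2) else 0) +
      ∑ s, if p = ι s then t * coeff (Finsupp.single s 1) (A ij.1 ij.2) else 0) with hM
  refine ⟨M, ?_⟩
  have hrprod : ∏ i, r i = (t ^ n)⁻¹ := by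
    simp only [hr, Finset.prod_ite_eq', Finset.mem_univ, if_true]
  -- values of the substituted entries where `x y ≠ 0`
  have hentry : ∀ (x : Fin m × Fin m → ℂ), x y ≠ 0 → ∀ i j : Fin m,
      eval x (linSubst _ ℂ M (X (i, j))) =
        r i * (x y * eval (fun s => t * x (ι s) / x y) (A i j)) := by
    intro x hx i j
    rw [linSubst_X, map_sum, ← InitialFormFamily.sum_homogenisedCoeff_mul_eq (hAdeg i j) ι y t x hx,
      Finset.mul_sum]
    refine Finset.sum_congr rfl fun p _ => ?_
    rw [smul_eval, eval_X, hM, mul_assoc]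
  -- values of the substituted determinant where `x y ≠ 0`
  have hdet : ∀ (x : Fin m × Fin m → ℂ), x y ≠ 0 →
      eval x (linSubst _ ℂ M (detPoly (Fin m) ℂ)) =
        (t ^ n)⁻¹ * (x y ^ m * eval ((t / x y) • (x ∘ ι)) F) := by
    intro x hx
    have hmat : ((Matrix.mvPolynomialX (Fin m) (Fin m) ℂ).map (linSubst _ ℂ M)).map (eval x) =
        Matrix.of fun i j => r i * (x y • A.map (eval fun s => t * x (ι s) / x y)) i j := by
      ext i j
      simp only [Matrix.map_apply, Matrix.mvPolynomialX_apply, Matrix.of_apply, Matrix.smul_apply,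
        smul_eq_mul]
      exact hentry x hx i j
    rw [detPoly, AlgHom.map_det, RingHom.map_det, AlgHom.mapMatrix_apply, RingHom.mapMatrix_apply,
      hmat, Matrix.det_mul_column, Matrix.det_smul, Fintype.card_fin, ← RingHom.mapMatrix_apply,
      ← RingHom.map_det, hAdet, hrprod]
    have hscale : (fun s => t * x (ι s) / x y) = (t / x y) • (x ∘ ι) := by
      funext s
      simp only [Pi.smul_apply, Function.comp_apply, smul_eq_mul]
      ring
    rw [hscale]
  -- Step 3: the two polynomials agree where `x y ≠ 0`, hence everywhere
  have hprod : (linSubst _ ℂ M (detPoly (Fin m) ℂ) - ∑ d ∈ Finset.range (m + 1),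
      ((t ^ n)⁻¹ * t ^ d) • (X y ^ (m - d) * rename ι (homogeneousComponent d F))) * X y = 0 := by
    apply MvPolynomial.funext
    intro x
    rw [map_mul, map_sub, map_zero, eval_X]
    by_cases hx : x y = 0
    · rw [hx, mul_zero]
    · rw [hdet x hx, InitialFormFamily.eval_smul_eq_sum_homogeneousComponent F hFdeg, map_sum,
        Finset.mul_sum, Finset.mul_sum, ← Finset.sum_sub_distrib, Finset.sum_mul]
      refine Finset.sum_eq_zero fun d hd => ?_
      have hdm : d ≤ m := Nat.lt_succ_iff.mp (Finset.mem_range.mp hd)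
      have hpow : x y ^ m = x y ^ d * x y ^ (m - d) := by
        rw [← pow_add, Nat.add_sub_cancel' hdm]
      rw [smul_eval, map_mul, map_pow, eval_X, eval_rename, hpow, div_pow]
      field_simp
      ring
  have hX : (X y : MvPolynomial (Fin m × Fin m) ℂ) ≠ 0 := X_ne_zero y
  exact sub_eq_zero.mp ((mul_eq_zero.mp hprod).resolve_right hX)

end Summit.ValiantsHypothesis.ValiantsHypothesis.Theorems.DetQPDetqpSuperquadratic

end
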